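import Mathlib

/-!
# Imbrie (2016), Assumption LLA — the interacting two-spin block: the kernel at a crossing and the first-order splitting by the interaction

CITATION HEADER (lean-in-tree rule 2026-08-18). J. Z. Imbrie, *On many-body localization for quantum spin chains*,
J. Stat. Phys. **163** (2016) 998–1048, doi 10.1007/s10955-016-1508-x, arXiv:1403.7837 [ImbrieJSP2016], eq. (1.1), eq. (1.3)
(Assumption LLA(ν, C)) and §4.2.1 (resonant blocks; first-order degenerate perturbation theory in the interaction).

WHAT IS PROVED (lemmas of the audit cell `pub-imbrie`, seat LLA gen 6, `LLA.md` gen-6 block N6 / GAP (11)(e), statement (C2) at first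
order; NOT statements of the paper).  By `TwoSpinDegeneracy.lean`, the two-spin block
`M = !![h₁+h₂+J, t₂, t₁, 0; t₂, h₁-h₂-J, 0, t₁; t₁, 0, -h₁+h₂-J, t₂; 0, t₁, t₂, -h₁-h₂+J]` (basis ↑↑, ↑↓, ↓↑, ↓↓; `t₁t₂ ≠ 0`) has a
degenerate level only at `J = 0`, `h₁²+t₁² = h₂²+t₂² =: r²`, the level being `0`.  Here, at such a point (hypotheses
`hr₁ : r² = h₁²+t₁²`, `hr₂ : r² = h₂²+t₂²`), with the explicit (unnormalised) product vectors
`e₁ = (t₁t₂, −t₁(r+h₂), (r−h₁)t₂, −(r−h₁)(r+h₂))` (spin 1 up-branch ⊗ spin 2 down-branch) and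
`e₂ = (t₁t₂, t₁(r−h₂), −(r+h₁)t₂, −(r+h₁)(r−h₂))`:
* `twoSpin_kernel_vec₁`, `twoSpin_kernel_vec₂`: `M e₁ = 0`, `M e₂ = 0` (J = 0) — they span the degenerate eigenspace;
* `twoSpin_kernel_norm₁/₂`: `|e₁|² = 4r²(r−h₁)(r+h₂)`, `|e₂|² = 4r²(r+h₁)(r−h₂)`; `twoSpin_kernel_orth`: `e₁ · e₂ = 0`;
* `twoSpin_kernel_zz₁₁/₂₂/₁₂`: the compression of the interaction `Z₁Z₂ = diag(1,−1,−1,1)` to the kernel: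
  `e₁·ZZe₁ = −4h₁h₂(r−h₁)(r+h₂)`, `e₂·ZZe₂ = −4h₁h₂(r+h₁)(r−h₂)`, `e₁·ZZe₂ = 4t₁²t₂²`;
* `twoSpin_firstOrder_splitting`: hence `(e₁·ZZe₁)|e₂|² = (e₂·ZZe₂)|e₁|²` (equal normalised diagonal entries `−h₁h₂/r²`: the interaction
  does NOT split the pair along the population axis) and `(e₁·ZZe₂)²·r⁴ = (t₁t₂)²·|e₁|²|e₂|²` (normalised off-diagonal entry `t₁t₂/r²`).
READING (first-order degenerate perturbation theory, not formalised): at a crossing, `δJ·Z₁Z₂` splits the middle pair by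
`2(t₁t₂/r²)|δJ| + O(δ²)`, while `δ(r₁−r₂)` splits it by `2|δ(r₁−r₂)|` along the orthogonal axis — the crossing is CONICAL with opening
`t₁t₂/r²` in the interaction direction (numerically: min of E₃−E₂ at |J| = 0.3 over [−4,4]³×[0.05,1]² is 1.8·10⁻⁴ ≈ 2(t₁t₂/r²)|J|).  This is the
constant of the "compact core" stratum of the small-gap volume (V2-int).  Says NOTHING about whether LLA holds (OPEN, pub-imbrie LLA.md).
No `sorry`, no new axioms, no definitions.
-/

namespace Literature.MathematicalPhysics.QuantumLattice.Imbrie2016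

/-- `M e₁ = 0` at `J = 0`, `r² = h₁²+t₁² = h₂²+t₂²` (e₁ = up-branch of spin 1 ⊗ down-branch of spin 2). [cite: ImbrieJSP2016, eq. (1.1), §4.2.1] -/
theorem twoSpin_kernel_vec₁ (h₁ h₂ t₁ t₂ r : ℝ) (hr₁ : r ^ 2 = h₁ ^ 2 + t₁ ^ 2) (hr₂ : r ^ 2 = h₂ ^ 2 + t₂ ^ 2) :
    (!![h₁+h₂, t₂, t₁, 0; t₂, h₁-h₂, 0, t₁; t₁, 0, -h₁+h₂, t₂; 0, t₁, t₂, -h₁-h₂] : Matrix (Fin 4) (Fin 4) ℝ).mulVec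
      ![t₁*t₂, -(t₁*(r+h₂)), (r-h₁)*t₂, -((r-h₁)*(r+h₂))] = 0 := by
  ext i
  fin_cases i
  · simp [Matrix.mulVec, dotProduct, Fin.sum_univ_four]
    ring
  · simp [Matrix.mulVec, dotProduct, Fin.sum_univ_four]
    linear_combination (-t₁) * hr₂
  · simp [Matrix.mulVec, dotProduct, Fin.sum_univ_four]
    linear_combination (-t₂) * hr₁
  · simp [Matrix.mulVec, dotProduct, Fin.sum_univ_four]
    linear_combination (r + h₂) * hr₁ + (-(r - h₁)) * hr₂

/-- `M e₂ = 0` at `J = 0`, `r² = h₁²+t₁² = h₂²+t₂²` (e₂ = down-branch of spin 1 ⊗ up-branch of spin 2). [cite: ImbrieJSP2016, eq. (1.1), §4.2.1] -/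
theorem twoSpin_kernel_vec₂ (h₁ h₂ t₁ t₂ r : ℝ) (hr₁ : r ^ 2 = h₁ ^ 2 + t₁ ^ 2) (hr₂ : r ^ 2 = h₂ ^ 2 + t₂ ^ 2) :
    (!![h₁+h₂, t₂, t₁, 0; t₂, h₁-h₂, 0, t₁; t₁, 0, -h₁+h₂, t₂; 0, t₁, t₂, -h₁-h₂] : Matrix (Fin 4) (Fin 4) ℝ).mulVec
      ![t₁*t₂, t₁*(r-h₂), -((r+h₁)*t₂), -((r+h₁)*(r-h₂))] = 0 := by
  ext i
  fin_cases i
  · simp [Matrix.mulVec, dotProduct, Fin.sum_univ_four]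
    ring
  · simp [Matrix.mulVec, dotProduct, Fin.sum_univ_four]
    linear_combination (-t₁) * hr₂
  · simp [Matrix.mulVec, dotProduct, Fin.sum_univ_four]
    linear_combination (-t₂) * hr₁
  · simp [Matrix.mulVec, dotProduct, Fin.sum_univ_four]
    linear_combination (-(r - h₂)) * hr₁ + (r + h₁) * hr₂

/-- `|e₁|² = 4r²(r−h₁)(r+h₂)`. [cite: ImbrieJSP2016, eq. (1.1), §4.2.1] -/
theorem twoSpin_kernel_norm₁ (h₁ h₂ t₁ t₂ r : ℝ) (hr₁ : r ^ 2 = h₁ ^ 2 + t₁ ^ 2) (hr₂ : r ^ 2 = h₂ ^ 2 + t₂ ^ 2) :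
    dotProduct ![t₁*t₂, -(t₁*(r+h₂)), (r-h₁)*t₂, -((r-h₁)*(r+h₂))] ![t₁*t₂, -(t₁*(r+h₂)), (r-h₁)*t₂, -((r-h₁)*(r+h₂))]
      = 4 * r ^ 2 * (r - h₁) * (r + h₂) := by
  simp [dotProduct, Fin.sum_univ_four]
  linear_combination (-(2 * r * (r + h₂)) + (r ^ 2 - h₂ ^ 2 - t₂ ^ 2)) * hr₁ + (-(2 * r * (r - h₁))) * hr₂

/-- `|e₂|² = 4r²(r+h₁)(r−h₂)`. [cite: ImbrieJSP2016, eq. (1.1), §4.2.1] -/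
theorem twoSpin_kernel_norm₂ (h₁ h₂ t₁ t₂ r : ℝ) (hr₁ : r ^ 2 = h₁ ^ 2 + t₁ ^ 2) (hr₂ : r ^ 2 = h₂ ^ 2 + t₂ ^ 2) :
    dotProduct ![t₁*t₂, t₁*(r-h₂), -((r+h₁)*t₂), -((r+h₁)*(r-h₂))] ![t₁*t₂, t₁*(r-h₂), -((r+h₁)*t₂), -((r+h₁)*(r-h₂))]
      = 4 * r ^ 2 * (r + h₁) * (r - h₂) := by
  simp [dotProduct, Fin.sum_univ_four]
  linear_combination (-(2 * r * (r - h₂)) + (r ^ 2 - h₂ ^ 2 - t₂ ^ 2)) * hr₁ + (-(2 * r * (r + h₁))) * hr₂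

/-- `e₁ · e₂ = 0` (only `r² = h₁²+t₁²` is needed: `e₁·e₂ = (r²−h₁²−t₁²)(r²−h₂²−t₂²)`). [cite: ImbrieJSP2016, eq. (1.1), §4.2.1] -/
theorem twoSpin_kernel_orth (h₁ h₂ t₁ t₂ r : ℝ) (hr₁ : r ^ 2 = h₁ ^ 2 + t₁ ^ 2) :
    dotProduct ![t₁*t₂, -(t₁*(r+h₂)), (r-h₁)*t₂, -((r-h₁)*(r+h₂))] ![t₁*t₂, t₁*(r-h₂), -((r+h₁)*t₂), -((r+h₁)*(r-h₂))] = 0 := by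
  simp [dotProduct, Fin.sum_univ_four]
  linear_combination (r ^ 2 - h₂ ^ 2 - t₂ ^ 2) * hr₁

/-- compression of the interaction `Z₁Z₂ = diag(1,−1,−1,1)`: `e₁ · ZZ e₁ = −4h₁h₂(r−h₁)(r+h₂)`. [cite: ImbrieJSP2016, eq. (1.1), §4.2.1] -/
theorem twoSpin_kernel_zz₁₁ (h₁ h₂ t₁ t₂ r : ℝ) (hr₁ : r ^ 2 = h₁ ^ 2 + t₁ ^ 2) (hr₂ : r ^ 2 = h₂ ^ 2 + t₂ ^ 2) :
    dotProduct ![t₁*t₂, -(t₁*(r+h₂)), (r-h₁)*t₂, -((r-h₁)*(r+h₂))]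
      ((!![1, 0, 0, 0; 0, -1, 0, 0; 0, 0, -1, 0; 0, 0, 0, 1] : Matrix (Fin 4) (Fin 4) ℝ).mulVec
        ![t₁*t₂, -(t₁*(r+h₂)), (r-h₁)*t₂, -((r-h₁)*(r+h₂))]) = -4 * h₁ * h₂ * (r - h₁) * (r + h₂) := by
  simp [Matrix.mulVec, dotProduct, Fin.sum_univ_four]
  linear_combination (2 * h₂ * (r + h₂) + (r ^ 2 - h₂ ^ 2 - t₂ ^ 2)) * hr₁ + (-(2 * h₁ * (r - h₁))) * hr₂

/-- `e₂ · ZZ e₂ = −4h₁h₂(r+h₁)(r−h₂)`. [cite: ImbrieJSP2016, eq. (1.1), §4.2.1] -/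
theorem twoSpin_kernel_zz₂₂ (h₁ h₂ t₁ t₂ r : ℝ) (hr₁ : r ^ 2 = h₁ ^ 2 + t₁ ^ 2) (hr₂ : r ^ 2 = h₂ ^ 2 + t₂ ^ 2) :
    dotProduct ![t₁*t₂, t₁*(r-h₂), -((r+h₁)*t₂), -((r+h₁)*(r-h₂))]
      ((!![1, 0, 0, 0; 0, -1, 0, 0; 0, 0, -1, 0; 0, 0, 0, 1] : Matrix (Fin 4) (Fin 4) ℝ).mulVec
        ![t₁*t₂, t₁*(r-h₂), -((r+h₁)*t₂), -((r+h₁)*(r-h₂))]) = -4 * h₁ * h₂ * (r + h₁) * (r - h₂) := by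
  simp [Matrix.mulVec, dotProduct, Fin.sum_univ_four]
  linear_combination (-(2 * h₂ * (r - h₂)) + (r ^ 2 - h₂ ^ 2 - t₂ ^ 2)) * hr₁ + (2 * h₁ * (r + h₁)) * hr₂

/-- `e₁ · ZZ e₂ = 4t₁²t₂²` (the interaction couples the two kernel vectors). [cite: ImbrieJSP2016, eq. (1.1), §4.2.1] -/
theorem twoSpin_kernel_zz₁₂ (h₁ h₂ t₁ t₂ r : ℝ) (hr₁ : r ^ 2 = h₁ ^ 2 + t₁ ^ 2) (hr₂ : r ^ 2 = h₂ ^ 2 + t₂ ^ 2) :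
    dotProduct ![t₁*t₂, -(t₁*(r+h₂)), (r-h₁)*t₂, -((r-h₁)*(r+h₂))]
      ((!![1, 0, 0, 0; 0, -1, 0, 0; 0, 0, -1, 0; 0, 0, 0, 1] : Matrix (Fin 4) (Fin 4) ℝ).mulVec
        ![t₁*t₂, t₁*(r-h₂), -((r+h₁)*t₂), -((r+h₁)*(r-h₂))]) = 4 * t₁ ^ 2 * t₂ ^ 2 := by
  simp [Matrix.mulVec, dotProduct, Fin.sum_univ_four]
  linear_combination (t₂ ^ 2 + (r ^ 2 - h₂ ^ 2)) * hr₁ + (2 * t₁ ^ 2) * hr₂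

/-- FIRST-ORDER SPLITTING at a crossing (cleared denominators): equal normalised diagonal entries of the compressed interaction,
`(e₁·ZZe₁)|e₂|² = (e₂·ZZe₂)|e₁|²` (both `= −h₁h₂/r²` after normalisation), and normalised off-diagonal entry `t₁t₂/r²`:
`(e₁·ZZe₂)² r⁴ = (t₁t₂)² |e₁|²|e₂|²`.  Stated on the closed forms of the previous lemmas. [cite: ImbrieJSP2016, eq. (1.1), §4.2.1] -/
theorem twoSpin_firstOrder_splitting (h₁ h₂ t₁ t₂ r : ℝ) (hr₁ : r ^ 2 = h₁ ^ 2 + t₁ ^ 2) (hr₂ : r ^ 2 = h₂ ^ 2 + t₂ ^ 2) :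
    (-4 * h₁ * h₂ * (r - h₁) * (r + h₂)) * (4 * r ^ 2 * (r + h₁) * (r - h₂))
        = (-4 * h₁ * h₂ * (r + h₁) * (r - h₂)) * (4 * r ^ 2 * (r - h₁) * (r + h₂)) ∧
      (4 * t₁ ^ 2 * t₂ ^ 2) ^ 2 * r ^ 4
        = (t₁ * t₂) ^ 2 * ((4 * r ^ 2 * (r - h₁) * (r + h₂)) * (4 * r ^ 2 * (r + h₁) * (r - h₂))) := by
  constructor
  · ring
  · have h1' : (r - h₁) * (r + h₁) = t₁ ^ 2 := by linear_combination hr₁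
    have h2' : (r + h₂) * (r - h₂) = t₂ ^ 2 := by linear_combination hr₂
    have : (4 * r ^ 2 * (r - h₁) * (r + h₂)) * (4 * r ^ 2 * (r + h₁) * (r - h₂))
        = 16 * r ^ 4 * ((r - h₁) * (r + h₁)) * ((r + h₂) * (r - h₂)) := by ring
    rw [this, h1', h2']
    ring

end Literature.MathematicalPhysics.QuantumLattice.Imbrie2016
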